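import Mathlib
import HarnessLib

/-!
# Route `IntegerScrew` — definitions: the continuum return function `K(u,r)` of LEMMA G and its companions
# `c(u)`, `A(u)`, `g(u)`, `I(u,r)` (PIVOT-LAW 13.44 / CONTINUUM-LIMIT §9, §16.2–16.3)

The comparison function of THEOREM C♯'s harmonic transfer (PIVOT-LAW §13.44, HOME/pivot/; CONTINUUM-LIMIT §16) is
built from ONE explicit function of two real variables,

  `K(u,r) = (1 − e^{−u(1+r)})/u − (1 − e^{−u})(1 − e^{−ur})/u²`

— LEMMA G: the probability that the constrained continuum process (particles `θ_i` with `Σθ_i ≤ 1`, deaths at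
rate `θ_i`, births uniform on the room at rate = room) started EMPTY with room `r` is empty at time `u`;
`K(u,1) = g(u) = ∫₀² |1−λ| e^{−uλ} dλ` is THEOREM C's limit return law of the truncated multiplicative walk at
`t = u/log M`.  This file only NAMES the five elementary functions so that the identities (H1)/(H2) of
CONTINUUM-LIMIT 16.3 can be kernel-checked against one definition of record (`IntegerScrewHarmonicK`):

* `ccpK u r` — `K(u,r)` above;
* `ccpc u = ((1+u)e^{−u} − 1)/u²` — the (negative) coefficient `c(u)` of (H1)/(H2);
* `ccpA u = (u − 1 + e^{−u})/u²` — the `e^{−ur}`-free part: `K = A − c·e^{−ur}`;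
* `ccpg u = (u − 1 + 2e^{−u} − (1+u)e^{−2u})/u²` — `g(u) = K(u,1)`;
* `ccpI u r = 2abr/u − [(1+a)(1−b) + 2(1−a)br]/u² + 2(1−a)(1−b)/u³` (`a = e^{−u}`, `b = e^{−ur}`) — the closed form
  of `∫₀^r [K(u,r−θ)(1 − e^{−uθ}) − K(u,r)] dθ`.

All five are total functions on `ℝ` (junk values at `u = 0`, where the intended values are the limits
`K(0⁺,r) = 1`, `c(0⁺) = −½`, `A(0⁺) = ½`, `g(0⁺) = 1`).  Nothing here is progress on `ζ`: these are names of
elementary functions.  References: PIVOT-LAW §13.44, CONTINUUM-LIMIT §9.0 (LEMMA G), §16.2–16.3 (rh-explicit,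
A6-PIVOT theory); M. Suzuki, J. Lond. Math. Soc. (2) 108 (2023) 1448–1487 [Suzuki2023] for the screw matrices
whose pivot law this serves.
-/

noncomputable section

-- D-0017: `Summit.<S>.<S>.…` is the designed namespace of a single-problem summit.
set_option linter.dupNamespace false

namespace Summit.RiemannHypothesis.RiemannHypothesis.Theorems.IntegerScrew

open Real

/-- LEMMA G's room factor: `K(u,r) = (1 − e^{−u(1+r)})/u − (1 − e^{−u})(1 − e^{−ur})/u²` — the return-to-empty
probability of the constrained continuum process from room `r` (CONTINUUM-LIMIT 9.0); `K(u,1) = g(u)`. -/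
def ccpK (u r : ℝ) : ℝ :=
  (1 - exp (-(u * (1 + r)))) / u - (1 - exp (-u)) * (1 - exp (-(u * r))) / u ^ 2

/-- `c(u) = ((1+u)e^{−u} − 1)/u²` (`< 0` for `u > 0`), the coefficient of (H1)/(H2). -/
def ccpc (u : ℝ) : ℝ := ((1 + u) * exp (-u) - 1) / u ^ 2

/-- `A(u) = (u − 1 + e^{−u})/u²` (`> 0` for `u > 0`): the `e^{−ur}`-free part of `K`, `K = A − c·e^{−ur}`. -/
def ccpA (u : ℝ) : ℝ := (u - 1 + exp (-u)) / u ^ 2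

/-- THEOREM C's limit return law `g(τ) = (τ − 1 + 2e^{−τ} − (1+τ)e^{−2τ})/τ² = ∫₀² |1−λ|e^{−τλ}dλ`. -/
def ccpg (u : ℝ) : ℝ := (u - 1 + 2 * exp (-u) - (1 + u) * exp (-(2 * u))) / u ^ 2

/-- The closed form of `I(u,r) = ∫₀^r [K(u,r−θ)(1 − e^{−uθ}) − K(u,r)] dθ` (CONTINUUM-LIMIT 16.3):
`2abr/u − [(1+a)(1−b) + 2(1−a)br]/u² + 2(1−a)(1−b)/u³`, `a = e^{−u}`, `b = e^{−ur}`. -/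
def ccpI (u r : ℝ) : ℝ :=
  2 * exp (-u) * exp (-(u * r)) * r / u
    - ((1 + exp (-u)) * (1 - exp (-(u * r))) + 2 * (1 - exp (-u)) * exp (-(u * r)) * r) / u ^ 2
    + 2 * (1 - exp (-u)) * (1 - exp (-(u * r))) / u ^ 3

end Summit.RiemannHypothesis.RiemannHypothesis.Theorems.IntegerScrew

end
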